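import Literature.Computability.Complexity.KarpCliqueNP
import Literature.Computability.Complexity.FoldCatBricks

/-!
# PneNP / PhaseTwins — `HardcoreCountSharpP` (stmt-PneNP-2722), part 1: canonical graph codes in `FP`

Route `PneNP/PhaseTwins`, support item stmt-PneNP-2722 (`HardcoreCountSharpP`): the hard-core
counting function `hardcoreCount Δ p q` (`HardcoreInapproximability.lean`; the function inlined in
the route) is in `#P`. The function reads its input `w` through the TOTAL decoder
`encodingGraph.decode` (`GraphEncodings.lean`): with `(u, v) = boolUnpair w` and `m = decodeNat u`
it sees the graph `SimpleGraph.fromRel` of the `m × m` bit matrix `v` when `|v| = m²`, and nothing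
otherwise. A witness relation can only be analysed on ONE code per graph, so (as for `#SAT`,
`SharpSATMembership.lean`, and the canonicalisations of `CanonicalCodes.lean`) the membership proof
goes through the polynomial-time re-encoding `canon = encode ∘ decode`, assembled here from the
tree's `FP` bricks (no machine is written):

* `canon w = ⟨canonF u, symFold w⟩`: the numeral is canonicalised by `Brick.canonF`
  (`= encodeNat ∘ decodeNat`), and the bit field is replaced, entry by entry (a concatenation fold
  `Brick.foldCat` over the positions `t < |v|`, pieces in the style of `CliqueNP.symPiece`), by the
  adjacency bit `[t / N ≠ t % N ∧ (v[t] ∨ v[(t % N) N + t / N])]` of `fromRel`, `N = min m |⟨canonF u, v⟩|`;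
* `decode_eq_none` / `decode_eq_some` (the decoder, case by case) and **`canon_eq_encode`**: when
  `|v| = m²`, `canon w` is the code `encodingGraph.encode ⟨m, G⟩` of the decoded graph; otherwise
  `|symFold w| = |v| ≠ m²` and the header test `CliqueNP.hdrT` rejects `⟨canon w, z⟩`
  (`hdrT_canon_of_ne`); `canon_mem_FP`.

Part 2 (`PhaseTwinsHardcoreCountSharpPTests.lean`) supplies the `P` tests on `⟨code, witness⟩`, part
3 (`PhaseTwinsHardcoreCountSharpP.lean`) the counting assembly and the route theorem.

References: L. G. Valiant, *The complexity of computing the permanent*, TCS 8 (1979), §2 (`#P`);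
S. Arora, B. Barak, *Computational Complexity: A Modern Approach* (2009), Def. 17.2, §0.1 (codes of
graphs), §1.3 (closure of polynomial time under composition and bounded loops).
-/

noncomputable section

-- `Summit.PneNP.PneNP.…` duplicates `PneNP` BY DESIGN (single-problem summit, D-0017 layout).
set_option linter.dupNamespace false

namespace Summit.PneNP.PneNP.Theorems

open Literature.Computability.Complexity Computability Brick OracleCompose Plumb HashBricks Polynomial

namespace HardcoreSharpP

/-! ### Small list lemmas -/

/-- A concatenation of one-bit pieces is the list of the bits. [folklore] -/
theorem ccat_single (b : ℕ → Bool) : ∀ k : ℕ, ccat (fun t => [b t]) k = (List.range k).map b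
  | 0 => rfl
  | k + 1 => by rw [ccat_succ, ccat_single b k, List.range_succ, List.map_append, List.map_singleton]

/-- Reading a mapped range. [folklore] -/
theorem getD_map_range (b : ℕ → Bool) {k t : ℕ} (ht : t < k) : ((List.range k).map b).getD t false = b t := by
  rw [List.getD_eq_getElem _ _ (by simpa using ht)]
  simp

/-! ### Pieces of the symmetrisation fold, on `⟨x₁, 1ᵗ⟩` with `x₁ = ⟨nc, bits⟩` -/

/-- On `⟨x₁, u⟩`: the unary dimension `1^{min ⟦nc⟧ |x₁|}` (`binToUnaryFn` against the ruler `x₁`). [folklore] -/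
def cN : List Bool → List Bool := binToUnaryFn ∘ fanoutFn fstF (fstF ∘ fstF)
/-- On `⟨x₁, 1ᵗ⟩`: `⟨1^{t / N}, 1^{t % N}⟩`, row and column of the flat index `t`. [folklore] -/
def cIJ : List Bool → List Bool := divModFn ∘ fanoutFn cN sndF
/-- On `⟨x₁, 1ᵗ⟩`: the bit `[bits t]`. [folklore] -/
def cB : List Bool → List Bool := headBitFn ∘ bitAtFn ∘ fanoutFn sndF (sndF ∘ fstF)
/-- On `⟨x₁, 1ᵗ⟩`: the transposed flat index `1^{(t % N) N + t / N}`. [folklore] -/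
def cTT : List Bool → List Bool := appF ∘ fanoutFn (umulFn ∘ fanoutFn (sndF ∘ cIJ) cN) (fstF ∘ cIJ)
/-- On `⟨x₁, 1ᵗ⟩`: the transposed bit `[bits ((t % N) N + t / N)]`. [folklore] -/
def cBT : List Bool → List Bool := headBitFn ∘ bitAtFn ∘ fanoutFn cTT (sndF ∘ fstF)
/-- On `⟨x₁, 1ᵗ⟩`: the diagonal test `[t / N = t % N]`. [folklore] -/
def cEq : List Bool → List Bool := eqPairFn ∘ cIJ

/-- **The symmetrisation piece** on `⟨x₁, 1ᵗ⟩`: the adjacency bit of `SimpleGraph.fromRel` at the flat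
index `t`, `[t / N ≠ t % N ∧ (bits t ∨ bits ((t % N) N + t / N))]`.
[cite: AroraBarak2009, §0.1 (undirected graphs as symmetric adjacency matrices)] -/
def symPiece : List Bool → List Bool := andFn (notFn cEq) (orFn cB cBT)

/-- `cN ∈ FP`. [folklore] -/
theorem cN_mem_FP : cN ∈ FP :=
  comp_mem_FP binToUnaryFn_mem_FP (fanoutFn_mem_FP fstF_mem_FP (comp_mem_FP fstF_mem_FP fstF_mem_FP))
/-- `cIJ ∈ FP`. [folklore] -/
theorem cIJ_mem_FP : cIJ ∈ FP := comp_mem_FP divModFn_mem_FP (fanoutFn_mem_FP cN_mem_FP sndF_mem_FP)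
/-- `cB ∈ FP`. [folklore] -/
theorem cB_mem_FP : cB ∈ FP :=
  comp_mem_FP headBitFn_mem_FP (comp_mem_FP bitAtFn_mem_FP (fanoutFn_mem_FP sndF_mem_FP (comp_mem_FP sndF_mem_FP fstF_mem_FP)))
/-- `cTT ∈ FP`. [folklore] -/
theorem cTT_mem_FP : cTT ∈ FP :=
  comp_mem_FP appF_mem_FP (fanoutFn_mem_FP (comp_mem_FP umulFn_mem_FP (fanoutFn_mem_FP (comp_mem_FP sndF_mem_FP cIJ_mem_FP) cN_mem_FP))
    (comp_mem_FP fstF_mem_FP cIJ_mem_FP))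
/-- `cBT ∈ FP`. [folklore] -/
theorem cBT_mem_FP : cBT ∈ FP :=
  comp_mem_FP headBitFn_mem_FP (comp_mem_FP bitAtFn_mem_FP (fanoutFn_mem_FP cTT_mem_FP (comp_mem_FP sndF_mem_FP fstF_mem_FP)))
/-- `cEq ∈ FP`. [folklore] -/
theorem cEq_mem_FP : cEq ∈ FP := comp_mem_FP eqPairFn_mem_FP cIJ_mem_FP
/-- **`symPiece ∈ FP`.** [cite: AroraBarak2009, §1.3] -/
theorem symPiece_mem_FP : symPiece ∈ FP :=
  andFn_mem_FP (notFn_mem_FP cEq_mem_FP) (orFn_mem_FP cB_mem_FP cBT_mem_FP)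

/-- `cB` is one-bit. [folklore] -/
theorem oneBit_cB : OneBit cB := oneBit_headBitFn.comp _
/-- `cBT` is one-bit. [folklore] -/
theorem oneBit_cBT : OneBit cBT := oneBit_headBitFn.comp _
/-- `cEq` is one-bit. [folklore] -/
theorem oneBit_cEq : OneBit cEq := oneBit_eqPairFn.comp _
/-- `symPiece` is one-bit (on every input). [folklore] -/
theorem oneBit_symPiece : OneBit symPiece :=
  oneBit_andFn (oneBit_notFn oneBit_cEq) (oneBit_orFn oneBit_cB oneBit_cBT)

/-- The symmetrised adjacency bit of an `N × N` bit matrix at the flat index `t`: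
`t / N ≠ t % N ∧ (bits t ∨ bits ((t % N) N + t / N))`. [folklore] -/
def symB (N : ℕ) (bits : List Bool) (t : ℕ) : Bool :=
  !decide (t / N = t % N) && (bits.getD t false || bits.getD (t % N * N + t / N) false)

/-- **Value of the symmetrisation piece** on `⟨⟨nc, bits⟩, 1ᵗ⟩`, with `N = min ⟦nc⟧ |⟨nc, bits⟩|`. [folklore] -/
theorem symPiece_apply (nc bits : List Bool) (t : ℕ) :
    symPiece (boolPair (boolPair nc bits) (ones t)) =
      [symB (min (bitsToNat nc) (boolPair nc bits).length) bits t] := by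
  set x₁ := boolPair nc bits with hx₁
  set N := min (bitsToNat nc) x₁.length with hNdef
  have hsN : cN (boolPair x₁ (ones t)) = ones N := by
    rw [cN, Function.comp_apply, fanoutFn_apply, fstF_boolPair, Function.comp_apply, fstF_boolPair, hx₁, fstF_boolPair,
      binToUnaryFn_boolPair]
  have hij : cIJ (boolPair x₁ (ones t)) = boolPair (ones (t / N)) (ones (t % N)) := by
    rw [cIJ, Function.comp_apply, fanoutFn_apply, hsN, sndF_boolPair, divModFn_boolPair]
  have hB : cB (boolPair x₁ (ones t)) = [bits.getD t false] := by
    rw [cB, Function.comp_apply, Function.comp_apply, fanoutFn_apply, sndF_boolPair, Function.comp_apply,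
      fstF_boolPair, hx₁, sndF_boolPair, bitAtFn_boolPair, headBitFn_apply, List.length_replicate,
      CliqueNP.headD_take_one_drop]
  have hTT : cTT (boolPair x₁ (ones t)) = ones (t % N * N + t / N) := by
    rw [cTT, Function.comp_apply, fanoutFn_apply, Function.comp_apply, fanoutFn_apply, Function.comp_apply, hij,
      sndF_boolPair, hsN, umulFn_boolPair, Function.comp_apply, hij, fstF_boolPair, appF_boolPair,
      List.replicate_append_replicate]
  have hBT : cBT (boolPair x₁ (ones t)) = [bits.getD (t % N * N + t / N) false] := by
    rw [cBT, Function.comp_apply, Function.comp_apply, fanoutFn_apply, hTT, Function.comp_apply, fstF_boolPair, hx₁,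
      sndF_boolPair, bitAtFn_boolPair, headBitFn_apply, List.length_replicate, CliqueNP.headD_take_one_drop]
  have hEq : cEq (boolPair x₁ (ones t)) = [decide (t / N = t % N)] := by
    rw [cEq, Function.comp_apply, hij, eqPairFn_boolPair]
    simp only [CliqueNP.ones_inj]
  rw [symPiece, andFn_apply (notFn_apply hEq) (orFn_apply hB hBT)]
  rfl

/-! ### The canonicaliser -/

/-- The context `x₁ = ⟨canonF u, v⟩` of an input `w` with `(u, v) = boolUnpair w`. [folklore] -/
def ctx : List Bool → List Bool := fanoutFn (canonF ∘ fstF) sndF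

/-- **The symmetrised bit field**: the concatenation fold of `symPiece` over the positions `t < |v|`.
[cite: AroraBarak2009, §1.3 (bounded loops)] -/
def symFold : List Bool → List Bool := foldCat 1 X symPiece ∘ fanoutFn ctx sndF

/-- **The canonicaliser** `canon w = ⟨canonF u, symFold w⟩`. [cite: AroraBarak2009, §0.1] -/
def canon : List Bool → List Bool := fanoutFn (canonF ∘ fstF) symFold

/-- `ctx ∈ FP`. [folklore] -/
theorem ctx_mem_FP : ctx ∈ FP := fanoutFn_mem_FP (comp_mem_FP canonF_mem_FP fstF_mem_FP) sndF_mem_FP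

/-- `symFold ∈ FP`. [cite: AroraBarak2009, §1.3 (bounded loops)] -/
theorem symFold_mem_FP : symFold ∈ FP :=
  comp_mem_FP (foldCat_mem_FP 1 X symPiece_mem_FP) (fanoutFn_mem_FP ctx_mem_FP sndF_mem_FP)

/-- **`canon ∈ FP`.** [cite: AroraBarak2009, §1.3] -/
theorem canon_mem_FP : canon ∈ FP := fanoutFn_mem_FP (comp_mem_FP canonF_mem_FP fstF_mem_FP) symFold_mem_FP

/-- The dimension read off `w`: `m = decodeNat u`. [folklore] -/
def dimW (w : List Bool) : ℕ := decodeNat (fstF w)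

/-- The cap `N = min m |⟨canonF u, v⟩|` used by the fold. [folklore] -/
def capW (w : List Bool) : ℕ := min (dimW w) (ctx w).length

/-- Value of the context. [folklore] -/
theorem ctx_apply (w : List Bool) : ctx w = boolPair (encodeNat (dimW w)) (sndF w) := by
  rw [ctx, fanoutFn_apply, Function.comp_apply, canonF_eq_encodeNat_decodeNat]; rfl

/-- **Value of the symmetrised bit field**: the list of the bits `symB N v t`, `t < |v|`. [folklore] -/
theorem symFold_apply (w : List Bool) :
    symFold w = (List.range (sndF w).length).map (symB (capW w) (sndF w)) := by
  have hctx := ctx_apply w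
  rw [symFold, Function.comp_apply, fanoutFn_apply, hctx, foldCat_apply]
  · rw [← ccat_single]
    refine ccat_congr fun t _ => ?_
    rw [symPiece_apply, bitsToNat_encodeNat, capW, hctx]
  · rw [eval_X, length_boolPair]; omega
  · intro t _
    rw [eval_one, oneBit_symPiece.length_eq]

/-- The symmetrised bit field has the length of the bit field. [folklore] -/
theorem length_symFold (w : List Bool) : (symFold w).length = (sndF w).length := by
  rw [symFold_apply, List.length_map, List.length_range]

/-- Value of the canonicaliser. [folklore] -/
theorem canon_apply (w : List Bool) : canon w = boolPair (encodeNat (dimW w)) (symFold w) := by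
  rw [canon, fanoutFn_apply, Function.comp_apply, canonF_eq_encodeNat_decodeNat]; rfl

/-! ### The decoder, case by case -/

/-- The graph decoded from an `m × m` bit matrix `v` (row-major, bit `j + m i` for the pair `(i, j)`):
`SimpleGraph.fromRel` of the bit relation. [cite: AroraBarak2009, §0.1 (adjacency-matrix representation)] -/
def Gdec (m : ℕ) (v : List Bool) : SimpleGraph (Fin m) :=
  SimpleGraph.fromRel fun i j : Fin m => v.getD ((j : ℕ) + m * i) false = true

/-- **Off the promise**: if `|v| ≠ m²` the input decodes to nothing. [folklore] -/
theorem decode_eq_none {w : List Bool} (h : (sndF w).length ≠ dimW w * dimW w) : encodingGraph.decode w = none := by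
  change sigmaBoolDecode encodingGraphFin (decodeNat (boolUnpair w).1) (boolUnpair w).2 = none
  have h' : ¬ (boolUnpair w).2.length = dimW w * dimW w := h
  simp only [sigmaBoolDecode, encodingGraphFin, encodingBitVec, Option.map_eq_none_iff]
  change (if h : (boolUnpair w).2.length = dimW w * dimW w then _ else none) = none
  rw [dif_neg h']

/-- **On the promise**: if `|v| = m²` the input decodes to `⟨m, Gdec m v⟩`. [folklore] -/
theorem decode_eq_some {w : List Bool} (h : (sndF w).length = dimW w * dimW w) :
    encodingGraph.decode w = some ⟨dimW w, Gdec (dimW w) (sndF w)⟩ := by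
  change sigmaBoolDecode encodingGraphFin (decodeNat (boolUnpair w).1) (boolUnpair w).2 = _
  have h' : (boolUnpair w).2.length = dimW w * dimW w := h
  simp only [sigmaBoolDecode, encodingGraphFin, encodingBitVec]
  change Option.map (Sigma.mk (dimW w)) (Option.map _ (if h : (boolUnpair w).2.length = dimW w * dimW w then _ else none)) = _
  rw [dif_pos h', Option.map_some, Option.map_some]
  congr 2
  unfold Gdec
  congr 1
  funext i j
  change ((boolUnpair w).2.get ((finProdFinEquiv (i, j)).cast h'.symm) = true) = ((sndF w).getD _ false = true)
  rw [List.get_eq_getElem, List.getD_eq_getElem]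
  rfl

/-! ### `canon = encode ∘ decode` -/

/-- `m ≤ m²`. [folklore] -/
theorem le_mul_self' (m : ℕ) : m ≤ m * m := by
  rcases Nat.eq_zero_or_pos m with rfl | hm
  · simp
  · exact Nat.le_mul_of_pos_left m hm

/-- On the promise the cap is the dimension: `N = m`. [folklore] -/
theorem capW_eq {w : List Bool} (h : (sndF w).length = dimW w * dimW w) : capW w = dimW w := by
  rw [capW, ctx_apply, length_boolPair]
  have := le_mul_self' (dimW w)
  omega

/-- The symmetrised bits of an `m × m` matrix are the adjacency bits of the decoded graph. [folklore] -/
theorem map_symB_eq_adjBits {m : ℕ} {v : List Bool} (h : v.length = m * m) :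
    (List.range v.length).map (symB m v) = CliqueNP.adjBits m (Gdec m v) := by
  refine List.ext_getElem (by simp [h]) fun t h1 h2 => ?_
  have ht : t < m * m := by simpa [h] using h1
  rw [← List.getD_eq_getElem _ false h1, ← List.getD_eq_getElem _ false h2, getD_map_range _ (by simpa using h1),
    CliqueNP.getD_adjBits _ ht]
  have hm : 0 < m := CliqueNP.pos_of_lt_mul ht
  unfold symB Gdec
  rw [SimpleGraph.fromRel_adj]
  simp only [ne_eq, Fin.mk.injEq]
  have e1 : t % m + m * (t / m) = t := Nat.mod_add_div t m
  have e2 : t / m + m * (t % m) = t % m * m + t / m := by ring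
  rw [e1, e2]
  by_cases hd : t / m = t % m
  · simp [hd]
  · simp [hd]

/-- **`canon = encode ∘ decode` on the promise**: `canon w` is the code of the decoded graph. [folklore] -/
theorem canon_eq_encode {w : List Bool} (h : (sndF w).length = dimW w * dimW w) :
    canon w = encodingGraph.encode ⟨dimW w, Gdec (dimW w) (sndF w)⟩ := by
  rw [canon_apply, encodingGraph_encode, CliqueNP.encodingGraphFin_encode_eq, symFold_apply, capW_eq h,
    map_symB_eq_adjBits h]

/-- **Off the promise the header test rejects**: `hdrT ⟨canon w, z⟩ = [0]` when `|v| ≠ m²`. [folklore] -/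
theorem hdrT_canon_of_ne {w : List Bool} (h : (sndF w).length ≠ dimW w * dimW w) (z : List Bool) :
    CliqueNP.hdrT (boolPair (canon w) z) = [false] := by
  rw [CliqueNP.hdrT_apply]
  have hb : CliqueNP.bitsF (boolPair (canon w) z) = symFold w := by
    rw [CliqueNP.bitsF, Function.comp_apply, fstF_boolPair, canon_apply, sndF_boolPair]
  have hd : CliqueNP.dimOf (boolPair (canon w) z) = dimW w := by
    rw [CliqueNP.dimOf, CliqueNP.ncF, Function.comp_apply, fstF_boolPair, canon_apply, fstF_boolPair, bitsToNat_encodeNat]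
  rw [hb, hd, length_symFold, decide_eq_false h]

/-- **The canonicaliser is decode-invariant**: `canon w` decodes to the same graph as `w` (on the
promise by `canon_eq_encode`; off it both decode to nothing). [folklore] -/
theorem decode_canon (w : List Bool) : encodingGraph.decode (canon w) = encodingGraph.decode w := by
  have hfst : fstF (canon w) = encodeNat (dimW w) := by rw [canon_apply, fstF_boolPair]
  have hsnd : sndF (canon w) = symFold w := by rw [canon_apply, sndF_boolPair]
  have hdim : dimW (canon w) = dimW w := by rw [dimW, hfst, decode_encodeNat]
  by_cases h : (sndF w).length = dimW w * dimW w
  · rw [canon_eq_encode h, encodingGraph.decode_encode, decode_eq_some h]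
  · have h' : (sndF (canon w)).length ≠ dimW (canon w) * dimW (canon w) := by
      rwa [hsnd, length_symFold, hdim]
    rw [decode_eq_none h', decode_eq_none h]

end HardcoreSharpP

end Summit.PneNP.PneNP.Theorems

end
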